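import Mathlib
import HarnessLib

/-!
# The abstract `(6,4)` bound from van den Berg–Kahn log-supermodularity: `μ(N ≥ 4) ≤ (4/3)·δ` for six relays — real-variable and counting core
# (lane prim-rate, constants-miner 1, gen 32; CANDIDATES §GEN-32 R317)

Support file for the closed crux `NoHeavyLowerTail` (stmt-CriticalPhenomena-4575), majority-gluing line; companion of
`…MajorityGluingSixAbstract` (`256/243` at `(4,3)`) and `…MajorityGluingSevenAbstract` (`16875/16384` at `(5,4)`).  For SIX relays and the
event «at least four cut from the hub» the abstract optimum of the hub-rooted van den Berg–Kahn programme (marginals `≤ δ`, the avoidance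
probabilities `U ↦ μ(all of U cut)` log-supermodular) is NOT a trigger law: it is `4/3` (numerically, kit j258594: extremal law = «a uniformly
random PAIR of relays joined» `2/27` each + «all cut» `2/9` + «exactly one cut» `1/27` each, per unit `δ`), and `4/3` is PROVED here by a
three-line certificate read off the KKT multipliers (kit j259166):
1. pointwise in the number `k ≤ 6` of cut relays, `1[k ≥ 4] ≤ (4/15)·C(k,2) − (3/20)·C(k,3)` (`coef_fourOfSix`), so at law level
   `μ(N ≥ 4) ≤ (4/15)·Σ_{pairs} μ(pair cut) − (3/20)·Σ_{triples} μ(triple cut)`;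
2. regrouping the pairs by the triples containing them (each pair lies in `4` of the `20` triples; `sum_pairs_by_triples`), the right side is
   `Σ_{triples t} [(1/15)·Σ_{pairs p ⊂ t} μ(p cut) − (3/20)·μ(t cut)]`;
3. per triple `{a,b,c}` (`three_pairs_le`): if `0 ≤ y₁, y₂, y₃ ≤ δ` and `yᵢ·yⱼ ≤ c·δ` for the three pairs — van den Berg–Kahn:
   `μ(ab cut)·μ(ac cut) ≤ μ(a cut)·μ(abc cut) ≤ δ·μ(abc cut)` — then `y₁ + y₂ + y₃ ≤ δ + (9/4)·c`, whence the triple's bracket is `≤ δ/15`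
   (`per_triple_le`) and the total is `≤ 20·δ/15 = (4/3)·δ`.  The key identity behind (3): for `y₂ ≤ y₁`,
   `y₁·(δ² + (9/4)y₁y₂ − δy₁ − 2δy₂) = δ(y₁ − y₂)(δ − y₁) + y₂(δ − (3/2)y₁)²`.
Equality throughout at the extremal law (`y = (2/3)δ`, `c = (4/9)δ`, `k = 4`).  This file: the real-variable lemmas, the numeric coefficient
inequality and the pair/triple double count; the percolation assembly is `…MajorityGluingEight`.  No definitions, no sorries. [folklore]
-/

namespace Summit.CriticalPhenomena.PercolationContinuityZ3.Theorems

namespace HubOnly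

open Finset

/-! ### The three-pairs lemma -/

/-- Ordered core of the three-pairs lemma: `0 ≤ y₂ ≤ y₁ ≤ δ`, `y₁y₂ ≤ cδ`, `0 ≤ c` ⟹ `y₁ + 2y₂ ≤ δ + (9/4)c`.
Key identity: `y₁(δ² + (9/4)y₁y₂ − δy₁ − 2δy₂) = δ(y₁ − y₂)(δ − y₁) + y₂(δ − (3/2)y₁)² ≥ 0`. [folklore] -/
theorem two_pairs_ordered (δ c y1 y2 : ℝ) (h2 : 0 ≤ y2) (h21 : y2 ≤ y1) (h1 : y1 ≤ δ) (hc : 0 ≤ c)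
    (h12 : y1 * y2 ≤ c * δ) : y1 + 2 * y2 ≤ δ + 9 / 4 * c := by
  rcases eq_or_lt_of_le (h2.trans h21) with hy1 | hy1
  · -- `y1 = 0`, hence `y2 = 0`
    have : y2 = 0 := le_antisymm (hy1 ▸ h21) h2
    rw [← hy1, this]; linarith
  · have hδ : 0 < δ := lt_of_lt_of_le hy1 h1
    have key : y1 * (δ ^ 2 + 9 / 4 * y1 * y2 - δ * y1 - 2 * δ * y2)
        = δ * ((y1 - y2) * (δ - y1)) + y2 * (δ - 3 / 2 * y1) ^ 2 := by ring
    have hnn : 0 ≤ y1 * (δ ^ 2 + 9 / 4 * y1 * y2 - δ * y1 - 2 * δ * y2) := by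
      rw [key]
      exact add_nonneg (mul_nonneg hδ.le (mul_nonneg (sub_nonneg.2 h21) (sub_nonneg.2 h1)))
        (mul_nonneg h2 (sq_nonneg _))
    have h3 : 0 ≤ δ ^ 2 + 9 / 4 * y1 * y2 - δ * y1 - 2 * δ * y2 := by
      by_contra hneg
      push Not at hneg
      nlinarith [mul_pos hy1 (neg_pos.2 hneg)]
    have h4 : 0 ≤ δ ^ 2 + 9 / 4 * (c * δ) - δ * y1 - 2 * δ * y2 := by nlinarith
    have h5 : 0 ≤ δ * (δ + 9 / 4 * c - y1 - 2 * y2) := by nlinarith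
    have h6 : 0 ≤ δ + 9 / 4 * c - y1 - 2 * y2 := by
      by_contra hneg
      push Not at hneg
      nlinarith [mul_pos hδ (neg_pos.2 hneg)]
    linarith

/-- **Three-pairs lemma.** `0 ≤ y₁, y₂, y₃ ≤ δ`, `0 ≤ c`, `yᵢyⱼ ≤ cδ` for the three pairs ⟹ `y₁ + y₂ + y₃ ≤ δ + (9/4)c`
(equality at `y = (2/3)δ`, `c = (4/9)δ` and at `y = (δ, 0, 0)`, `c = 0`). [folklore] -/
theorem three_pairs_le (δ c y1 y2 y3 : ℝ) (h1 : 0 ≤ y1) (h2 : 0 ≤ y2) (h3 : 0 ≤ y3)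
    (d1 : y1 ≤ δ) (d2 : y2 ≤ δ) (d3 : y3 ≤ δ) (hc : 0 ≤ c)
    (h12 : y1 * y2 ≤ c * δ) (h13 : y1 * y3 ≤ c * δ) (h23 : y2 * y3 ≤ c * δ) :
    y1 + y2 + y3 ≤ δ + 9 / 4 * c := by
  rcases le_total y2 y1 with a21 | a12
  · rcases le_total y3 y2 with a32 | a23
    · have := two_pairs_ordered δ c y1 y2 h2 a21 d1 hc h12; linarith
    · rcases le_total y3 y1 with a31 | a13
      · have := two_pairs_ordered δ c y1 y3 h3 a31 d1 hc h13; linarith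
      · have := two_pairs_ordered δ c y3 y1 h1 a13 d3 hc (by linarith [mul_comm y1 y3]); linarith
  · rcases le_total y3 y1 with a31 | a13
    · have := two_pairs_ordered δ c y2 y1 h1 a12 d2 hc (by linarith [mul_comm y1 y2]); linarith
    · rcases le_total y3 y2 with a32 | a23
      · have := two_pairs_ordered δ c y2 y3 h3 a32 d2 hc h23; linarith
      · have := two_pairs_ordered δ c y3 y2 h2 a23 d3 hc (by linarith [mul_comm y2 y3]); linarith

/-- **Per-triple bound.** Under the hypotheses of `three_pairs_le`: `(1/15)(y₁ + y₂ + y₃) − (3/20)c ≤ δ/15` — the `c`-terms cancel exactly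
(`(1/15)·(9/4) = 3/20`). [folklore] -/
theorem per_triple_le (δ c y1 y2 y3 : ℝ) (h1 : 0 ≤ y1) (h2 : 0 ≤ y2) (h3 : 0 ≤ y3)
    (d1 : y1 ≤ δ) (d2 : y2 ≤ δ) (d3 : y3 ≤ δ) (hc : 0 ≤ c)
    (h12 : y1 * y2 ≤ c * δ) (h13 : y1 * y3 ≤ c * δ) (h23 : y2 * y3 ≤ c * δ) :
    1 / 15 * (y1 + y2 + y3) - 3 / 20 * c ≤ δ / 15 := by
  have := three_pairs_le δ c y1 y2 y3 h1 h2 h3 d1 d2 d3 hc h12 h13 h23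
  linarith

/-! ### The pointwise coefficient inequality and the pair/triple double count -/

/-- Pointwise majorant of `1[k ≥ 4]` for `k ≤ 6` cut relays by binomial counts of cut pairs and cut triples:
`1[4 ≤ k] ≤ (4/15)·C(k,2) − (3/20)·C(k,3)` (values `0, 0, 4/15, 13/20, 1, 7/6, 1`). [folklore] -/
theorem coef_fourOfSix (k : ℕ) (hk : k ≤ 6) :
    (if 4 ≤ k then (1 : ℝ) else 0) ≤ 4 / 15 * (k.choose 2 : ℝ) - 3 / 20 * (k.choose 3 : ℝ) := by
  interval_cases k <;> simp [Nat.choose] <;> norm_num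

/-- For `t ⊆ T`, the `j`-subsets of `t` are the `j`-subsets of `T` inside `t`. [folklore] -/
theorem powersetCard_eq_filter_subset {α : Type*} [DecidableEq α] (T t : Finset α) (ht : t ⊆ T) (j : ℕ) :
    t.powersetCard j = (T.powersetCard j).filter (· ⊆ t) := by
  ext p
  simp only [mem_powersetCard, mem_filter]
  constructor
  · rintro ⟨hp, hc⟩; exact ⟨⟨hp.trans ht, hc⟩, hp⟩
  · rintro ⟨⟨_, hc⟩, hp⟩; exact ⟨hp, hc⟩

/-- **Double count.** In a `6`-set every pair lies in exactly `4` triples: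
`Σ_{t ⊆ T, |t| = 3} Σ_{p ⊆ t, |p| = 2} f p = 4·Σ_{p ⊆ T, |p| = 2} f p`. [folklore] -/
theorem sum_pairs_by_triples {α : Type*} [DecidableEq α] (T : Finset α) (hT : T.card = 6) (f : Finset α → ℝ) :
    ∑ t ∈ T.powersetCard 3, ∑ p ∈ t.powersetCard 2, f p = 4 * ∑ p ∈ T.powersetCard 2, f p := by
  have h1 : ∀ t ∈ T.powersetCard 3, ∑ p ∈ t.powersetCard 2, f p =
      ∑ p ∈ T.powersetCard 2, if p ⊆ t then f p else 0 := by
    intro t ht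
    rw [powersetCard_eq_filter_subset T t (mem_powersetCard.1 ht).1 2, sum_filter]
  rw [sum_congr rfl h1, sum_comm, mul_sum]
  refine sum_congr rfl fun p hp => ?_
  rw [← sum_filter, sum_const, nsmul_eq_mul]
  have hpT : p ⊆ T := (mem_powersetCard.1 hp).1
  have hpc : p.card = 2 := (mem_powersetCard.1 hp).2
  have hcount := card_filter_powersetCard_subset p T 3 hpT (by omega)
  rw [hT, hpc] at hcount
  have : ((T.powersetCard 3).filter (p ⊆ ·)).card = 4 := by
    rw [hcount]; decide
  rw [this]; norm_num

/-- For `C ⊆ T`, the `j`-subsets of `T` contained in `C` number `C(|C|, j)`. [folklore] -/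
theorem card_filter_subset_powersetCard {α : Type*} [DecidableEq α] (T C : Finset α) (hC : C ⊆ T) (j : ℕ) :
    ((T.powersetCard j).filter (· ⊆ C)).card = C.card.choose j := by
  rw [← powersetCard_eq_filter_subset T C hC j, card_powersetCard]

end HubOnly

end Summit.CriticalPhenomena.PercolationContinuityZ3.Theorems
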